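import Literature.AnabelianGeometry.AbsoluteAnabelian.HolomorphicEllipticCuspidalizationCuspExtension
import Literature.AnabelianGeometry.AbsoluteAnabelian.AutHolomorphicSpacesOpensInclusion
import Literature.AnabelianGeometry.AbsoluteAnabelian.RCHolomorphicOpensTransfer
import Literature.AnabelianGeometry.AbsoluteAnabelian.HolomorphicEllipticCuspidalizationDeck
import Literature.AnabelianGeometry.AbsoluteAnabelian.CoorientationsProofs
import Literature.Geometry.Kaehler.ComplexTorusHolomorphicMaps
import Literature.Geometry.Kaehler.ComplexTorusEvenEllipticFunctions
import HarnessLib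

/-!
# [AbsTopIII] Cor 2.7 (b), sub-node (b).8: cuspidal torsion points of the punctured torus are torsion

PROOF-ONLY companion (no new definitions, no new named facts) of
`HolomorphicEllipticCuspidalization.lean` (p414370, seat abc-iut-L4-t12; sub-DAG
`plan/L4/SUBDAG-AbsTopIII-Cor-27.md`, row Cor-27.b.r10), seat abc-iut-w5-d053; part 2 of 2 (part 1:
`HolomorphicEllipticCuspidalizationCuspExtension.lean`, the continuous extension `h̄ : T → T` of
`cov ∘ imm⁻¹`).  S. Mochizuki, *Topics in absolute anabelian geometry III*, §2, Corollary 2.7 (b),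
kurims p. 59: "one may construct the torsion points of [the elliptic curve determined by] `E` as the
points in the complement of the image of such morphisms `U ↪ E`" for elliptic cuspidalization diagrams
`E ↩ U → E` with `E ↩ U`, `U → E` "co-holomorphic".

Main result: `cuspidalTorsionPointsAreTorsion_of : LocalMorphismIsRCHolomorphic →
CuspidalTorsionPointsAreTorsion` — the typed sub-node (b).8 at the model (every cuspidal torsion point
of `𝔼 = T ∖ {0}`, `T = ComplexTorus Φ`, is of finite additive order in `T`), GRANTED [AbsTopIII]
Cor 2.3 (i) (`LocalMorphismIsRCHolomorphic`, the named fact of `AutHolomorphicSpaces.lean`, consumed BY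
NAME; nothing else is assumed).

Route (for a diagram `D` over `𝔼` and a point `x ∉ range D.imm`):
* `h̄` is RC-HOLOMORPHIC on `imm(𝕌)` (`isHolAt_or_isAntiHolAt_extend_cov`): `cov ∘ imm⁻¹ :
  imm(𝕌) → 𝔼` is a morphism of the Aut-holomorphic spaces of these GENUINE Riemann surfaces, by
  composition on the generalised carrier (`IsMorphism.comp` / `.symm` and the inclusion/cancellation
  lemmas of `AutHolomorphicSpacesOpensInclusion.lean`) — the abstract charts of `𝕌` (the diagram
  carries no `IsManifold` structure on `𝕌`) and the field `coholomorphic` are never used — hence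
  RC-holomorphic by Cor 2.3 (i); of CONSTANT type on the connected open `imm(𝕌) = T ∖ (finite)`
  (`forall_isHolAt_or_forall_isAntiHolAt_extend_cov`; `RCHolomorphicOpensTransfer.lean`, w5-d226's
  `isPathConnected_compl_of_finite`);
* `ψ := h̄` (holomorphic case) or `ψ := h̄ ∘ h̄` (anti-holomorphic case; `anti ∘ anti = hol`,
  `RCHolomorphicCalculus`) is holomorphic on all of `T` (`mdifferentiable_extend_cov_or_comp`: removable
  singularities at finitely many points, the tree's `RiemannSurface.mdifferentiableAt_of_continuousAt`),
  fixes `0`, hence is ADDITIVE (Lange–Birkenhake Prop. 1.1.6, the tree's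
  `ComplexTorus.map_add_of_mdifferentiable`); `ψ x = 0` and the zero set of `ψ` is finite, so `x` has
  finite order.
Sub-node (b).7 (`AbelianCoverOfPuncturedTorusExtends`), degree theory and the uniformization input
(c).3 are NOT used.  Refereed pre-IUT material; nothing here bears on the disputed [IUTchIII]
Cor. 3.12; no side taken; typed ≠ discharged for the remaining named input Cor 2.3 (i).
-/

noncomputable section

namespace Literature.AnabelianGeometry.AbsoluteAnabelian

namespace HolomorphicEllipticCuspidalization

open _root_.TopologicalSpace _root_.Topology _root_.Set _root_.Function _root_.Filter
open scoped _root_.Manifold _root_.ContDiff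
open Literature.Geometry.Kaehler (ComplexTorus)

/-- In a `T₁` space, a punctured neighbourhood of any point avoids a given finite set. [folklore] -/
private theorem eventually_nhdsNE_not_mem {X : Type*} [TopologicalSpace X] [T1Space X] {S : Set X}
    (hS : S.Finite) (p : X) : ∀ᶠ t in 𝓝[≠] p, t ∉ S := by
  have h1 : (S \ {p})ᶜ ∈ 𝓝 p := (hS.subset fun t ht => ht.1).isClosed.compl_mem_nhds
    fun h => h.2 rfl
  filter_upwards [mem_nhdsWithin_of_mem_nhds h1, self_mem_nhdsWithin] with t ht hne
  exact fun hts => ht ⟨hts, hne⟩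

/-- An element killed by an additive self-map of an additive group with finitely many zeros has
finite order (it lies in the finite kernel). [folklore] -/
private theorem isOfFinAddOrder_of_additive_of_finite {G : Type*} [AddCommGroup G] (ψ : G → G)
    (hadd : ∀ a b, ψ (a + b) = ψ a + ψ b) (hfin : {t | ψ t = 0}.Finite) {x : G} (hx : ψ x = 0) :
    IsOfFinAddOrder x := by
  let f : G →+ G := AddMonoidHom.mk' ψ hadd
  have hker : ∀ t, t ∈ f.ker ↔ ψ t = 0 := fun t => AddMonoidHom.mem_ker
  haveI : Finite f.ker := by
    have h : (f.ker : Set G).Finite := hfin.subset fun t ht => (hker t).1 ht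
    exact h.to_subtype
  have h1 : IsOfFinAddOrder (⟨x, (hker x).2 hx⟩ : f.ker) := isOfFinAddOrder_of_finite _
  obtain ⟨n, hn, hnx⟩ := (isOfFinAddOrder_iff_nsmul_eq_zero).1 h1
  exact (isOfFinAddOrder_iff_nsmul_eq_zero).2 ⟨n, hn, by
    simpa using congrArg (Subtype.val : f.ker → G) hnx⟩

section Diagram

variable {ι : Type} [Fintype ι] {Φ : (ι → ℝ) ≃L[ℝ] ℂ}
  (D : EllipticCuspidalizationDiagram ↥(puncturedTorus Φ))

/-! ### `h̄` is RC-holomorphic on the image of `𝕌` (Cor 2.3 (i) BY NAME) -/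

/-- **`cov ∘ imm⁻¹` is RC-holomorphic**, granted Cor 2.3 (i) (`LocalMorphismIsRCHolomorphic`): it is a
morphism of the Aut-holomorphic spaces of the GENUINE Riemann surfaces `imm(𝕌) ⊆ T` and `𝔼` (composite
of `cov` with the inverse of the isomorphism `𝕌 ≅ imm(𝕌)`, on the generalised carrier; the abstract
charts of `𝕌` are never used), hence RC-holomorphic; read on the extension `h̄ : T → T` at the points
`imm(u)`. [cite: MochizukiAbsTopIII2015, Corollary 2.7 (b) p.59] -/
theorem isHolAt_or_isAntiHolAt_extend_cov (hRC : LocalMorphismIsRCHolomorphic) (u : D.U) :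
    IsHolAt (Function.extend (fun u : D.U => ((D.imm u : ↥(puncturedTorus Φ)) : ComplexTorus Φ))
        (fun u => ((D.cov u : ↥(puncturedTorus Φ)) : ComplexTorus Φ)) (fun _ => 0))
        ((D.imm u : ↥(puncturedTorus Φ)) : ComplexTorus Φ) ∨
      IsAntiHolAt (Function.extend (fun u : D.U => ((D.imm u : ↥(puncturedTorus Φ)) : ComplexTorus Φ))
        (fun u => ((D.cov u : ↥(puncturedTorus Φ)) : ComplexTorus Φ)) (fun _ => 0))
        ((D.imm u : ↥(puncturedTorus Φ)) : ComplexTorus Φ) := by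
  set ι₁ := (fun u : D.U => ((D.imm u : ↥(puncturedTorus Φ)) : ComplexTorus Φ)) with hι₁
  set hbar := Function.extend ι₁ (fun u => ((D.cov u : ↥(puncturedTorus Φ)) : ComplexTorus Φ))
    (fun _ => 0) with hhbar
  have he : IsOpenEmbedding ι₁ := isOpenEmbedding_coe_imm D
  -- the open `V₁ = imm(𝕌) ⊆ 𝔼 ⊆ T`
  let V₁ : Opens (ComplexTorus Φ) := ⟨Set.range ι₁, he.isOpen_range⟩
  have hle : V₁ ≤ puncturedTorus Φ := by
    rintro _ ⟨v, rfl⟩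
    exact (D.imm v).2
  -- `eU : 𝕌 ≅ V₁`
  let f : D.U → ↥V₁ := fun v => ⟨ι₁ v, v, rfl⟩
  have hf_inj : Function.Injective f := fun a b h =>
    he.injective (congrArg (fun y : ↥V₁ => (y : ComplexTorus Φ)) h)
  have hf_surj : Function.Surjective f := by
    rintro ⟨_, v, rfl⟩
    exact ⟨v, rfl⟩
  have hf_cont : Continuous f := he.continuous.subtype_mk _
  have hf_open : IsOpenMap f := by
    intro s hs
    have hfs : f '' s = Subtype.val ⁻¹' (ι₁ '' s) := by
      ext ⟨t, ht⟩
      constructor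
      · rintro ⟨a, ha, hfa⟩
        exact ⟨a, ha, congrArg Subtype.val hfa⟩
      · rintro ⟨a, ha, hat⟩
        exact ⟨a, ha, Subtype.ext hat⟩
    rw [hfs]
    exact (he.isOpenMap s hs).preimage continuous_subtype_val
  let eU : D.U ≃ₜ ↥V₁ :=
    (Equiv.ofBijective f ⟨hf_inj, hf_surj⟩).toHomeomorphOfContinuousOpen hf_cont hf_open
  have heU : ∀ v, eU v = f v := fun v => rfl
  -- `imm = (V₁ ↪ 𝔼) ∘ eU`
  have himm : (fun y : ↥V₁ => (⟨(y : ComplexTorus Φ), hle y.2⟩ : ↥(puncturedTorus Φ))) ∘ ⇑eU =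
      D.imm := by
    funext v
    rfl
  -- the morphism chain on the generalised carrier
  have hM2 : IsMorphism (AutHolStructure.ofCharted D.U) (AutHolStructure.ofCharted ↥V₁) ⇑eU := by
    refine IsMorphism.of_inclusion_comp hle eU.isLocalHomeomorph ?_
    rw [himm]
    exact D.imm_morphism
  have hM3 : IsMorphism (AutHolStructure.ofCharted ↥V₁) (AutHolStructure.ofCharted D.U) ⇑eU.symm :=
    hM2.symm
  have hM4 : IsMorphism (AutHolStructure.ofCharted ↥V₁)
      (AutHolStructure.ofCharted ↥(puncturedTorus Φ)) (D.cov ∘ ⇑eU.symm) :=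
    D.cov_morphism.comp hM3
  have hM5 : IsRCHolomorphic (D.cov ∘ ⇑eU.symm) := IsMorphism.isRCHolomorphic_of hRC hM4
  -- transfer to `hbar` at `ι₁ u = eU u`
  have hagree : ∀ y : ↥V₁,
      (((D.cov ∘ ⇑eU.symm) y : ↥(puncturedTorus Φ)) : ComplexTorus Φ) = hbar (y : ComplexTorus Φ) := by
    intro y
    obtain ⟨v, rfl⟩ := eU.surjective y
    rw [Function.comp_apply, eU.symm_apply_apply]
    exact (extend_cov_apply_imm D v).symm
  rcases hM5 (eU u) with h | h
  · exact Or.inl (IsHolAt.of_restrict_opens (U := V₁) (V := puncturedTorus Φ) (φ := hbar)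
      (e := D.cov ∘ ⇑eU.symm) hagree h)
  · exact Or.inr (IsAntiHolAt.of_restrict_opens (U := V₁) (V := puncturedTorus Φ) (φ := hbar)
      (e := D.cov ∘ ⇑eU.symm) hagree h)

/-- **The type of `h̄` is constant on the image of `𝕌`** (a connected open: `T` minus a finite set),
granted Cor 2.3 (i). [cite: MochizukiAbsTopIII2015, Corollary 2.7 (b) p.59] -/
theorem forall_isHolAt_or_forall_isAntiHolAt_extend_cov (hRC : LocalMorphismIsRCHolomorphic) :
    (∀ u : D.U, IsHolAt (Function.extend (fun u : D.U => ((D.imm u : ↥(puncturedTorus Φ)) : ComplexTorus Φ))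
        (fun u => ((D.cov u : ↥(puncturedTorus Φ)) : ComplexTorus Φ)) (fun _ => 0))
        ((D.imm u : ↥(puncturedTorus Φ)) : ComplexTorus Φ)) ∨
      ∀ u : D.U, IsAntiHolAt (Function.extend
          (fun u : D.U => ((D.imm u : ↥(puncturedTorus Φ)) : ComplexTorus Φ))
          (fun u => ((D.cov u : ↥(puncturedTorus Φ)) : ComplexTorus Φ)) (fun _ => 0))
        ((D.imm u : ↥(puncturedTorus Φ)) : ComplexTorus Φ) := by
  set ι₁ := (fun u : D.U => ((D.imm u : ↥(puncturedTorus Φ)) : ComplexTorus Φ)) with hι₁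
  have he : IsOpenEmbedding ι₁ := isOpenEmbedding_coe_imm D
  have hW : IsPreconnected (Set.range ι₁) := by
    have h := isPathConnected_compl_of_finite Φ (finite_compl_range_coe_imm D)
    rw [compl_compl] at h
    exact h.isConnected.isPreconnected
  have key := forall_isHolAt_or_forall_isAntiHolAt_of_injOn (continuous_extend_cov D) he.isOpen_range
    hW (fun p hp => by
      obtain ⟨u, rfl⟩ := hp
      exact exists_injOn_extend_cov D u)
    (fun p hp => by
      obtain ⟨u, rfl⟩ := hp
      exact isHolAt_or_isAntiHolAt_extend_cov D hRC u)
  rcases key with h | h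
  · exact Or.inl fun u => h _ ⟨u, rfl⟩
  · exact Or.inr fun u => h _ ⟨u, rfl⟩

/-- **`h̄` or `h̄ ∘ h̄` is holomorphic on all of `T`** (granted Cor 2.3 (i)): in the holomorphic case
`h̄` is holomorphic off a finite set and continuous, in the anti-holomorphic case `h̄ ∘ h̄` is
(`anti ∘ anti = hol`); Riemann's removable singularity theorem in the charts of `T`.
[cite: MochizukiAbsTopIII2015, Corollary 2.7 (b) p.59] -/
theorem mdifferentiable_extend_cov_or_comp (hRC : LocalMorphismIsRCHolomorphic) :
    MDifferentiable 𝓘(ℂ, ℂ) 𝓘(ℂ, ℂ)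
        (Function.extend (fun u : D.U => ((D.imm u : ↥(puncturedTorus Φ)) : ComplexTorus Φ))
          (fun u => ((D.cov u : ↥(puncturedTorus Φ)) : ComplexTorus Φ)) (fun _ => 0)) ∨
      MDifferentiable 𝓘(ℂ, ℂ) 𝓘(ℂ, ℂ)
        ((Function.extend (fun u : D.U => ((D.imm u : ↥(puncturedTorus Φ)) : ComplexTorus Φ))
            (fun u => ((D.cov u : ↥(puncturedTorus Φ)) : ComplexTorus Φ)) (fun _ => 0)) ∘
          (Function.extend (fun u : D.U => ((D.imm u : ↥(puncturedTorus Φ)) : ComplexTorus Φ))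
            (fun u => ((D.cov u : ↥(puncturedTorus Φ)) : ComplexTorus Φ)) (fun _ => 0))) := by
  set ι₁ := (fun u : D.U => ((D.imm u : ↥(puncturedTorus Φ)) : ComplexTorus Φ)) with hι₁
  set hbar := Function.extend ι₁ (fun u => ((D.cov u : ↥(puncturedTorus Φ)) : ComplexTorus Φ))
    (fun _ => 0) with hhbar
  have hc : Continuous hbar := continuous_extend_cov D
  have hfin : (Set.range ι₁)ᶜ.Finite := finite_compl_range_coe_imm D
  rcases forall_isHolAt_or_forall_isAntiHolAt_extend_cov D hRC with hhol | hanti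
  · left
    intro p
    refine Literature.Geometry.Kaehler.RiemannSurface.mdifferentiableAt_of_continuousAt
      hc.continuousAt ?_
    filter_upwards [eventually_nhdsNE_not_mem hfin p] with t ht
    rw [Set.mem_compl_iff, not_not] at ht
    obtain ⟨u, rfl⟩ := ht
    exact (hhol u).mdifferentiableAt
  · right
    intro p
    refine Literature.Geometry.Kaehler.RiemannSurface.mdifferentiableAt_of_continuousAt
      (hc.comp hc).continuousAt ?_
    have hfin' : ((Set.range ι₁)ᶜ ∪ hbar ⁻¹' (Set.range ι₁)ᶜ).Finite :=
      hfin.union (finite_preimage_extend_cov D hfin)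
    filter_upwards [eventually_nhdsNE_not_mem hfin' p] with t ht
    rw [Set.mem_union, not_or, Set.mem_compl_iff, not_not, Set.mem_preimage, Set.mem_compl_iff,
      not_not] at ht
    obtain ⟨⟨u, hu⟩, ⟨u', hu'⟩⟩ := ht
    have h1 : IsAntiHolAt hbar t := hu ▸ hanti u
    have h2 : IsAntiHolAt hbar (hbar t) := hu' ▸ hanti u'
    exact (h2.comp_isAntiHolAt h1).mdifferentiableAt

end Diagram

/-! ### (b).8 -/

/-- **Sub-node (b).8 of [AbsTopIII] Cor 2.7 (b) at the model, GRANTED Cor 2.3 (i)** (named fact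
`LocalMorphismIsRCHolomorphic`, consumed by name): every cuspidal torsion point of the punctured
complex torus `𝔼 = T ∖ {0}` — a point off the image of some elliptic cuspidalization diagram
`𝔼 ↩ 𝕌 → 𝔼` — is a torsion point of `T`.  Proof: `h̄ = cov ∘ imm⁻¹` extended by `0` is continuous
(`cov` proper) and RC-holomorphic of constant type on `imm(𝕌) = T ∖ (finite)`; so `ψ := h̄` (hol. case)
or `ψ := h̄ ∘ h̄` (anti-hol. case) is a holomorphic self-map of `T` fixing `0`, hence additive
(Lange–Birkenhake 1.1.6, the tree's `ComplexTorus.map_add_of_mdifferentiable`); the cuspidal point is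
killed by `ψ`, whose zero set is finite. [cite: MochizukiAbsTopIII2015, Corollary 2.7 (b) p.59] -/
theorem cuspidalTorsionPointsAreTorsion_of (hRC : LocalMorphismIsRCHolomorphic) :
    CuspidalTorsionPointsAreTorsion := by
  intro ι _ Φ x hx
  obtain ⟨D, hxD⟩ := hx
  set ι₁ := (fun u : D.U => ((D.imm u : ↥(puncturedTorus Φ)) : ComplexTorus Φ)) with hι₁
  set hbar := Function.extend ι₁ (fun u => ((D.cov u : ↥(puncturedTorus Φ)) : ComplexTorus Φ))
    (fun _ => 0) with hhbar
  have hx1 : (x : ComplexTorus Φ) ∉ Set.range ι₁ := by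
    rintro ⟨u, hu⟩
    exact hxD ⟨u, Subtype.ext hu⟩
  have hx0 : hbar x = 0 := extend_cov_apply_of_not_mem D hx1
  have hzero : {t | hbar t = 0} = (Set.range ι₁)ᶜ := by
    ext t
    rw [Set.mem_setOf_eq, Set.mem_compl_iff, ← extend_cov_ne_zero_iff D t, not_not]
  have hfin0 : {t | hbar t = 0}.Finite := hzero ▸ finite_compl_range_coe_imm D
  rcases mdifferentiable_extend_cov_or_comp D hRC with hmd | hmd
  · have hadd := Literature.Geometry.Kaehler.ComplexTorus.map_add_of_mdifferentiable hmd
      (extend_cov_zero D)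
    exact isOfFinAddOrder_of_additive_of_finite hbar hadd hfin0 hx0
  · have h00 : (hbar ∘ hbar) 0 = 0 := by
      rw [Function.comp_apply, show hbar 0 = 0 from extend_cov_zero D]
      exact extend_cov_zero D
    have hadd := Literature.Geometry.Kaehler.ComplexTorus.map_add_of_mdifferentiable hmd h00
    refine isOfFinAddOrder_of_additive_of_finite (hbar ∘ hbar) hadd ?_ ?_
    · have hsub : {t | (hbar ∘ hbar) t = 0} ⊆ hbar ⁻¹' (Set.range ι₁)ᶜ := by
        intro t ht
        have ht' : hbar t ∈ {s | hbar s = 0} := ht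
        rw [hzero] at ht'
        exact ht'
      exact (finite_preimage_extend_cov D (finite_compl_range_coe_imm D)).subset hsub
    · rw [Function.comp_apply, hx0]
      exact extend_cov_zero D

end HolomorphicEllipticCuspidalization

end Literature.AnabelianGeometry.AbsoluteAnabelian
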